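import Literature.AlgebraicGeometry.Motives.AbelianVarietyFrobeniusKernelTorsion
import Literature.AlgebraicGeometry.Motives.AbelianVarietyBaseChange
import HarnessLib

/-!
# Frobenius-kernel block reduction: naturality of `A[F_q]` in homomorphisms, the layer criterion, and sums of endomorphisms

Topic `Literature/AlgebraicGeometry/Motives`; namespaces `Literature.AlgebraicGeometry.Motives` (§2, any `k`-group scheme) and
`Literature.AlgebraicGeometry.Motives.AbelianVariety` (§1, §3, §4).  THEOREMS ONLY (no definition, no named fact, no instance, no notation,
no `sorry`).  Cell `hodgecm-mathlib` (D-0151), FLOOR 0, P6 «MOD programme» (crux hLiu418 = stmt-HodgeConjecture-24832, `--supports`): organ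
**(BLK) «FROBENIUS-KERNEL BLOCK REDUCTION»** (desk F0P6d-plan (g0), 2026-09-01, after ST1-CUT v1 §1) — the two generic glue facts the heart
(HEART-FROB §0 (i)) uses to check the inclusion `A[F_q] ⊆ K` BLOCK BY BLOCK under the idempotents of `𝒪_F ⊗ ℤ_p` acting on `A[q]`:
**(BLK-nat)** the Frobenius kernel is natural in homomorphisms `u : A → B` (`ι_{A[F_q]} ≫ u` factors through `ι_{B[F_q]}`; for `u ∈ End A`
through `ι_{A[F_q]}` itself), and a point of `A` lying in a closed subgroup (a LAYER `j : G ↪ A`) is killed by `F^{(r)}_{A∕k}` iff it is killed by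
the layer's own relative Frobenius; **(BLK-sum)** for endomorphisms `ε₁, …, ε_m` and a subgroup `κ : K ↪ A`, a point `t` all of whose components
`t ≫ ε_i` factor through `κ` has `t ≫ (Σ ε_i)` factoring through `κ` — so `t` itself does as soon as `Σ ε_i` fixes `t` (e.g. `Σ ε_i = 𝟙_A`, or
`Σ ι(a_v) ≡ 1` on `A[q]`).  Sequel of ★ `AbelianVarietyFrobeniusKernelTorsion` ((FK0)+(FK∞)+(ÉT)).  HC_CM is proved only modulo the printed
citations until rung 0 closes; this file is generic and changes no count.

THE PRINT.  [SGA3I] VII_A 4.1 and [MumfordAV1970] §15 (p. 146): the relative Frobenius `F_{X∕k} : X → X^{(q)}` is functorial in `X`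
(`F_{Y∕k} ∘ f = f^{(q)} ∘ F_{X∕k}`, ★ `relFrobeniusOver_comp_map`, ★ `AbelianVariety.relFrobenius_comp`) and compatible with group structures
(it is a homomorphism for every `k`-group scheme, the twist carrying the base-changed structure); a `T`-point `g` of a `k`-group scheme `G` is
killed by `F_{G∕k}` iff `F_T^{abs} ≫ g = F_T^{abs} ≫ 1` (both sides are determined by their projection to `G`), a criterion which does not
see the ambient group — whence the LAYER form.  [GortzWedhorn2020] Definition 4.45 (2): kernels as fibre products, functorial in squares.
(BLK-sum) is the group law read on `T`-points: `t ≫ (Σ ε_i) = ∏ (t ≫ ε_i)` ([MumfordAV1970] §19, first paragraph: addition of homomorphisms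
is pointwise; ★ `AbelianVariety.hom_hom_hom_add`, Mathlib `MonObj.comp_mul` ∕ `MonObj.mul_comp`).

* §1 (abelian varieties, any field of exponential characteristic `p`) the CRITERION `comp_relFrobenius_eq_one_iff`
  («`t ≫ F^{(r)}_{A∕k} = 1 ↔ F_T^{abs} ≫ t = F_T^{abs} ≫ 1`», the `Spec k`∕`p^r` analogue of ★ `RelFrobenius.comp_relFrobenius_eq_one_iff`) and
  `comp_relFrobenius_eq_one_iff'` (right-hand side `(T → Spec k) ≫ Spec Frob^r ≫ e_A`).
* §2 (any `k`-group scheme `G`, twist `G^{(q)} = (Over.pullback (Spec Frob^r)).obj G` with Mathlib's transported structure, `open scoped Obj`)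
  `unit_comp_relFrobeniusOver`, `mul_comp_relFrobeniusOver_tensorHom`, `isMonHom_relFrobeniusOver` (`F_{G∕k}` is a homomorphism — ★
  `AbelianVariety.one_comp_relFrobeniusOver`∕`mul_comp_relFrobeniusOver` verbatim for a general `G`), and the criterion
  `comp_relFrobeniusOver_eq_one_iff`.
* §3 **(BLK-nat)** `comp_hom_comp_relFrobenius_eq_one` (points), `exists_hom_ker_relFrobenius_map` (`Ker F_A → Ker F_B` over `u`, a homomorphism),
  LAYER forms `comp_comp_relFrobenius_eq_one_iff_of_mono` (absolute shape, needs only `j.left` mono) and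
  `comp_comp_relFrobenius_eq_one_iff_comp_relFrobeniusOver_eq_one` («`(t ≫ j) ≫ F_A = 1 ↔ t ≫ F_G = 1`»).
* §4 **(BLK-sum)** `exists_fac_comp_sum` (`t ≫ Σ ε_i` factors through `κ` when every `t ≫ ε_i` does), `exists_fac_of_comp_sum_eq` (`t` itself, when
  `Σ ε_i` fixes `t`), `exists_fac_of_sum_eq_id` (`Σ ε_i = 𝟙_A`).

## References
* [SGA3I] M. Demazure, A. Grothendieck (eds.), *SGA 3, Tome I*, Exp. VII_A §4, 4.1 (relative Frobenius: functoriality, products, group structures).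
* [MumfordAV1970] D. Mumford, *Abelian Varieties* (1970), §15 (p. 146: `F_{A∕k}`), §19 (first paragraph: `Hom(X, Y)` under pointwise addition).
* [GortzWedhorn2020] U. Görtz, T. Wedhorn, *Algebraic Geometry I* (2nd ed. 2020), Definition 4.45 (2) (p. 117), Section (4.7) (base change).
-/

set_option autoImplicit false

-- `((Over.pullback f).obj X).left = pullback X.hom f` and the transported unit `η[(F.obj G)] = ε F ≫ F.map η[G]` are definitional only above
-- `instances` transparency (as in ★ `AbelianVarietyFrobeniusTwistVariety`); the option is set per declaration where a `change` needs it.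

universe v u

open CategoryTheory Limits MonoidalCategory CartesianMonoidalCategory AlgebraicGeometry

noncomputable section

namespace Literature.AlgebraicGeometry.Motives

open Literature.AlgebraicGeometry.GroupSchemes Literature.AlgebraicGeometry.GroupSchemes.GroupSchemeKernel
open scoped MonObj Obj

/-! ## §1 The criterion «killed by `F^{(r)}_{A∕k}`» in absolute-Frobenius shape -/

namespace AbelianVariety

section Criterion

variable {k : Type u} [Field k] (p : ℕ) [ExpChar k p] (r : ℕ) (A : AbelianVariety k)

set_option backward.isDefEq.respectTransparency false in
/-- The trivial `T`-point of `A^{(p^r)}` projects to `F_T^{abs} ≫ 1_A(T)`: `(1 : T → A^{(q)}) ≫ pr_A = F_T^{abs} ≫ (1 : T → A)` (it is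
`(1 : T → A) ≫ F_{A∕k}`, and ★ `comp_relFrobenius_left_comp_twistFst`). [cite: SGA3I, VII_A 4.1] -/
theorem one_left_comp_twistFst (T : SchemeOver k) :
    (1 : T ⟶ (A.frobeniusTwist p r).X).left ≫ twistFst p r A.X = absFrobeniusOver p r T ≫ (1 : T ⟶ A.X).left := by
  rw [← MonObj.one_comp (A.relFrobenius p r).hom.hom.hom, comp_relFrobenius_left_comp_twistFst]

set_option backward.isDefEq.respectTransparency false in
/-- **CRITERION: `t ≫ F^{(r)}_{A∕k} = 1 ↔ F_T^{abs} ≫ t = F_T^{abs} ≫ 1`.**  A `T`-point `t` of the abelian variety `A` (`T` any `k`-scheme)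
is killed by the relative `p^r`-Frobenius iff `t` and the trivial point agree after PRE-composition with the absolute `p^r`-Frobenius of `T`
(both `F(t)` and `1` are determined by their projections to `A`, which are `F_T^{abs} ≫ t` and `F_T^{abs} ≫ 1`).  The `Spec k` ∕ `q = p^r`
analogue of ★ `RelFrobenius.comp_relFrobenius_eq_one_iff`. [cite: SGA3I, VII_A 4.1] [cite: MumfordAV1970, §15 (p. 146)] -/
theorem comp_relFrobenius_eq_one_iff {T : SchemeOver k} (t : T ⟶ A.X) :
    t ≫ (A.relFrobenius p r).hom.hom.hom = 1 ↔ absFrobeniusOver p r T ≫ t.left = absFrobeniusOver p r T ≫ (1 : T ⟶ A.X).left := by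
  constructor
  · intro h
    rw [← comp_relFrobenius_left_comp_twistFst, h, one_left_comp_twistFst]
  · intro h
    exact frobeniusTwistOver_hom_ext p r (by rw [comp_relFrobenius_left_comp_twistFst, h, one_left_comp_twistFst])

set_option backward.isDefEq.respectTransparency false in
/-- The same criterion with the right-hand side spelled through the unit section: `t ≫ F^{(r)}_{A∕k} = 1 ↔ F_T^{abs} ≫ t = (T → Spec k) ≫
Spec Frob^r ≫ e_A` (`F_T^{abs}` lies over `Spec Frob^r`, ★ `absFrobeniusOver_comp_hom`). [cite: SGA3I, VII_A 4.1] [cite: MumfordAV1970, §15 (p. 146)] -/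
theorem comp_relFrobenius_eq_one_iff' {T : SchemeOver k} (t : T ⟶ A.X) :
    t ≫ (A.relFrobenius p r).hom.hom.hom = 1 ↔
      absFrobeniusOver p r T ≫ t.left = T.hom ≫ frobSpec k p r ≫ (η[A.X] : 𝟙_ (SchemeOver k) ⟶ A.X).left := by
  have hu : (toUnit T).left = T.hom := (Category.comp_id _).symm.trans (Over.w (toUnit T))
  rw [comp_relFrobenius_eq_one_iff, Hom.one_def, Over.comp_left, hu, ← Category.assoc, absFrobeniusOver_comp_hom, Category.assoc]

end Criterion

end AbelianVariety

/-! ## §2 Any `k`-group scheme: `F_{G∕k}` is a homomorphism for the transported structure on `G^{(q)}`, and the criterion -/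

section GroupScheme

variable {k : Type u} [Field k] (p : ℕ) [ExpChar k p] (r : ℕ) (G : SchemeOver k) [GrpObj G]

set_option backward.isDefEq.respectTransparency false in
/-- `e_G ≫ F_{G∕k} = e_{G^{(q)}}` for ANY `k`-group scheme `G`, the twist `G^{(q)} = (Over.pullback (Spec Frob^r)).obj G` carrying Mathlib's
transported group structure (`open scoped Obj`; for an abelian variety this is ★ `AbelianVariety.one_comp_relFrobeniusOver`, same proof).
[cite: SGA3I, VII_A 4.1] -/
theorem unit_comp_relFrobeniusOver :
    η[G] ≫ relFrobeniusOver p r G = (η : 𝟙_ (SchemeOver k) ⟶ frobeniusTwistOver p r G) := by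
  change _ = Functor.LaxMonoidal.ε (Over.pullback (frobSpec k p r)) ≫ (Over.pullback (frobSpec k p r)).map η[G]
  apply frobeniusTwistOver_hom_ext
  rw [comp_relFrobeniusOver_left_comp_fst, Over.comp_left, Category.assoc, pullback_map_left_comp_twistFst,
    ε_left_comp_twistFst_assoc, absFrobeniusOver_tensorUnit]

set_option backward.isDefEq.respectTransparency false in
/-- `m_G ≫ F_{G∕k} = (F_{G∕k} × F_{G∕k}) ≫ m_{G^{(q)}}` for any `k`-group scheme `G` (transported structure on the twist; for an abelian
variety ★ `AbelianVariety.mul_comp_relFrobeniusOver`, same proof). [cite: SGA3I, VII_A 4.1] -/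
theorem mul_comp_relFrobeniusOver_tensorHom :
    μ[G] ≫ relFrobeniusOver p r G =
      (relFrobeniusOver p r G ⊗ₘ relFrobeniusOver p r G) ≫ (μ : _ ⟶ frobeniusTwistOver p r G) := by
  change _ = _ ≫ Functor.LaxMonoidal.μ (Over.pullback (frobSpec k p r)) G G ≫ (Over.pullback (frobSpec k p r)).map μ[G]
  apply frobeniusTwistOver_hom_ext
  rw [comp_relFrobeniusOver_left_comp_fst, Over.comp_left, Over.comp_left, Category.assoc, Category.assoc,
    pullback_map_left_comp_twistFst, tensorHom_μ_left_comp_twistFst_assoc]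

/-- **`F_{G∕k} : G → G^{(q)}` is a homomorphism of `k`-group schemes** for every `k`-group scheme `G` (transported structure on the twist).
[cite: SGA3I, VII_A 4.1] -/
theorem isMonHom_relFrobeniusOver : IsMonHom (relFrobeniusOver p r G) where
  one_hom := unit_comp_relFrobeniusOver p r G
  mul_hom := mul_comp_relFrobeniusOver_tensorHom p r G

variable {G} in
/-- **CRITERION for a `k`-group scheme: `g ≫ F_{G∕k} = 1 ↔ F_T^{abs} ≫ g = F_T^{abs} ≫ 1`** (transported structure on `G^{(q)}`).
[cite: SGA3I, VII_A 4.1] -/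
theorem comp_relFrobeniusOver_eq_one_iff {T : SchemeOver k} (g : T ⟶ G) :
    g ≫ relFrobeniusOver p r G = 1 ↔ absFrobeniusOver p r T ≫ g.left = absFrobeniusOver p r T ≫ (1 : T ⟶ G).left := by
  haveI := isMonHom_relFrobeniusOver p r G
  have h1 : (1 : T ⟶ frobeniusTwistOver p r G).left ≫ twistFst p r G = absFrobeniusOver p r T ≫ (1 : T ⟶ G).left := by
    rw [← MonObj.one_comp (relFrobeniusOver p r G), comp_relFrobeniusOver_left_comp_fst]
  constructor
  · intro h
    rw [← comp_relFrobeniusOver_left_comp_fst, h, h1]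
  · intro h
    exact frobeniusTwistOver_hom_ext p r (by rw [comp_relFrobeniusOver_left_comp_fst, h, h1])

end GroupScheme

namespace AbelianVariety

/-! ## §3 (BLK-nat) naturality of the Frobenius kernel; the layer forms -/

section Naturality

variable {k : Type u} [Field k] (p : ℕ) [ExpChar k p] (r : ℕ) {A B : AbelianVariety k}

/-- **(BLK-nat), points: a point of `A` killed by `F^{(r)}_{A∕k}` is sent by every homomorphism `u : A → B` to a point of `B` killed by
`F^{(r)}_{B∕k}`** (naturality `u ≫ F_B = F_A ≫ u^{(q)}`, ★ `hom_hom_hom_comp_relFrobenius`). [cite: MumfordAV1970, §15 (p. 146)] [cite: SGA3I, VII_A 4.1] -/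
theorem comp_hom_comp_relFrobenius_eq_one (u : A ⟶ B) {T : SchemeOver k} (t : T ⟶ A.X)
    (ht : t ≫ (A.relFrobenius p r).hom.hom.hom = 1) : (t ≫ u.hom.hom.hom) ≫ (B.relFrobenius p r).hom.hom.hom = 1 := by
  rw [Category.assoc, hom_hom_hom_comp_relFrobenius p r u, ← Category.assoc, ht, MonObj.one_comp]

variable (A) in
/-- (BLK-nat) for endomorphisms, points form: `u ∈ End A` preserves «killed by `F^{(r)}_{A∕k}`». [cite: MumfordAV1970, §15 (p. 146)] -/
theorem comp_end_comp_relFrobenius_eq_one (u : A ⟶ A) {T : SchemeOver k} (t : T ⟶ A.X)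
    (ht : t ≫ (A.relFrobenius p r).hom.hom.hom = 1) : (t ≫ u.hom.hom.hom) ≫ (A.relFrobenius p r).hom.hom.hom = 1 :=
  comp_hom_comp_relFrobenius_eq_one p r u t ht

/-- **(BLK-nat) on kernels: `ι_{A[F_q]} ≫ u` factors through `ι_{B[F_q]}`** by a homomorphism `ψ : Ker F^{(r)}_{A∕k} → Ker F^{(r)}_{B∕k}`
(the kernel lift of `ι_A ≫ u` along the naturality square; for `u ∈ End A` take `B = A`). [cite: GortzWedhorn2020, Definition 4.45 (2) (p. 117)]
[cite: MumfordAV1970, §15 (p. 146)] -/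
theorem exists_hom_ker_relFrobenius_map (u : A ⟶ B) :
    ∃ ψ : ker (A.relFrobenius p r).hom.hom.hom ⟶ ker (B.relFrobenius p r).hom.hom.hom,
      ψ ≫ kerι _ = kerι _ ≫ u.hom.hom.hom ∧ IsMonHom ψ :=
  ⟨kerLift (kerι _ ≫ u.hom.hom.hom) (comp_hom_comp_relFrobenius_eq_one p r u _ (kerι_comp _)), kerLift_ι _ _,
    isMonHom_kerLift _ _⟩

variable (A)

/-- **(BLK-nat), LAYER form in absolute shape.**  For a homomorphism `j : G → A` of `k`-group schemes which is a monomorphism on underlying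
schemes (a closed subgroup, a LAYER `𝒢_n ↪ A`) and a `T`-point `t` of `G`: `t ≫ j` is killed by `F^{(r)}_{A∕k}` iff `F_T^{abs} ≫ t = F_T^{abs}
≫ 1_G(T)` — the layer's own «killed by `F_q`» condition, which does not see `A` (cancel the monomorphism `j` in the criterion of §1).
[cite: SGA3I, VII_A 4.1] [cite: MumfordAV1970, §15 (p. 146)] -/
theorem comp_comp_relFrobenius_eq_one_iff_of_mono {G : SchemeOver k} [GrpObj G] (j : G ⟶ A.X) [IsMonHom j] [Mono j.left]
    {T : SchemeOver k} (t : T ⟶ G) :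
    (t ≫ j) ≫ (A.relFrobenius p r).hom.hom.hom = 1 ↔
      absFrobeniusOver p r T ≫ t.left = absFrobeniusOver p r T ≫ (1 : T ⟶ G).left := by
  have h1 : (1 : T ⟶ A.X) = (1 : T ⟶ G) ≫ j := (MonObj.one_comp j).symm
  rw [A.comp_relFrobenius_eq_one_iff p r, h1, Over.comp_left, Over.comp_left, ← Category.assoc, ← Category.assoc, cancel_mono]

/-- **(BLK-nat), LAYER form: `(t ≫ j) ≫ F^{(r)}_{A∕k} = 1 ↔ t ≫ F^{(r)}_{G∕k} = 1`** — a `T`-point of `A[F_q]` lying in the closed subgroup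
`j : G ↪ A` is killed by THE LAYER's relative Frobenius `F_{G∕k} : G → G^{(q)}` (transported structure on `G^{(q)}`, §2), and conversely.
[cite: SGA3I, VII_A 4.1] [cite: MumfordAV1970, §15 (p. 146)] -/
theorem comp_comp_relFrobenius_eq_one_iff_comp_relFrobeniusOver_eq_one {G : SchemeOver k} [GrpObj G] (j : G ⟶ A.X) [IsMonHom j]
    [Mono j.left] {T : SchemeOver k} (t : T ⟶ G) :
    (t ≫ j) ≫ (A.relFrobenius p r).hom.hom.hom = 1 ↔ t ≫ relFrobeniusOver p r G = 1 := by
  rw [A.comp_comp_relFrobenius_eq_one_iff_of_mono p r j t, comp_relFrobeniusOver_eq_one_iff]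

/-- The layer form for a CLOSED subgroup (`j.left` a closed immersion is a monomorphism). [cite: SGA3I, VII_A 4.1] -/
theorem comp_comp_relFrobenius_eq_one_iff_of_isClosedImmersion {G : SchemeOver k} [GrpObj G] (j : G ⟶ A.X) [IsMonHom j]
    [IsClosedImmersion j.left] {T : SchemeOver k} (t : T ⟶ G) :
    (t ≫ j) ≫ (A.relFrobenius p r).hom.hom.hom = 1 ↔ t ≫ relFrobeniusOver p r G = 1 :=
  A.comp_comp_relFrobenius_eq_one_iff_comp_relFrobeniusOver_eq_one p r j t

end Naturality

/-! ## §4 (BLK-sum) sums of endomorphisms and factorisation through a subgroup -/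

section Sum

variable {k : Type u} [Field k] (A : AbelianVariety k) {K T : SchemeOver k} [GrpObj K] (κ : K ⟶ A.X) [IsMonHom κ] (t : T ⟶ A.X)

/-- **(BLK-sum).**  Let `κ : K → A` be a homomorphism of `k`-group schemes (a subgroup), `t` a `T`-point of `A`, and `ε_i` (`i ∈ s`) morphisms
`A → A` of abelian varieties.  If every component `t ≫ ε_i` factors through `κ`, so does `t ≫ (Σ_{i ∈ s} ε_i)`: on `T`-points the sum of
homomorphisms is the pointwise product (★ `hom_hom_hom_add`, Mathlib `MonObj.comp_mul`), and products of points of `K` map to products under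
the homomorphism `κ` (`MonObj.mul_comp`). [cite: MumfordAV1970, §19 (first paragraph) and §15 (p. 146)] -/
theorem exists_fac_comp_sum {J : Type*} (s : Finset J) (ε : J → (A ⟶ A))
    (h : ∀ i ∈ s, ∃ u : T ⟶ K, u ≫ κ = t ≫ (ε i).hom.hom.hom) :
    ∃ u : T ⟶ K, u ≫ κ = t ≫ (∑ i ∈ s, ε i).hom.hom.hom := by
  classical
  induction s using Finset.induction_on with
  | empty =>
    refine ⟨1, ?_⟩
    rw [Finset.sum_empty, MonObj.one_comp]
    change 1 = t ≫ (1 : A.X ⟶ A.X)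
    rw [MonObj.comp_one]
  | insert a s ha ih =>
    obtain ⟨ua, hua⟩ := h a (Finset.mem_insert_self a s)
    obtain ⟨u, hu⟩ := ih fun i hi => h i (Finset.mem_insert_of_mem hi)
    refine ⟨ua * u, ?_⟩
    rw [Finset.sum_insert ha, hom_hom_hom_add, MonObj.comp_mul, MonObj.mul_comp, hua, hu]

/-- **(BLK-sum), factorisation of `t` itself**: if moreover `Σ ε_i` FIXES the point `t` (`t ≫ (Σ ε_i) = t` — e.g. `Σ ε_i = 𝟙_A`, or `t` a point
of `A[q]` and `Σ ι(a_v) ≡ 1 (mod q)` for idempotent approximants `a_v`), then `t` factors through `κ`. [cite: MumfordAV1970, §19 (first paragraph)] -/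
theorem exists_fac_of_comp_sum_eq {J : Type*} (s : Finset J) (ε : J → (A ⟶ A)) (hsum : t ≫ (∑ i ∈ s, ε i).hom.hom.hom = t)
    (h : ∀ i ∈ s, ∃ u : T ⟶ K, u ≫ κ = t ≫ (ε i).hom.hom.hom) : ∃ u : T ⟶ K, u ≫ κ = t := by
  obtain ⟨u, hu⟩ := A.exists_fac_comp_sum κ t s ε h
  exact ⟨u, hu.trans hsum⟩

/-- **(BLK-sum) for a partition of unity `Σ ε_i = 𝟙_A` in `End A`**: a point all of whose components `t ≫ ε_i` lie in the subgroup `κ` lies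
in `κ`. [cite: MumfordAV1970, §19 (first paragraph)] -/
theorem exists_fac_of_sum_eq_id {J : Type*} (s : Finset J) (ε : J → (A ⟶ A)) (hsum : ∑ i ∈ s, ε i = 𝟙 A)
    (h : ∀ i ∈ s, ∃ u : T ⟶ K, u ≫ κ = t ≫ (ε i).hom.hom.hom) : ∃ u : T ⟶ K, u ≫ κ = t :=
  A.exists_fac_of_comp_sum_eq κ t s ε (by rw [hsum]; exact Category.comp_id t) h

end Sum

end AbelianVariety

end Literature.AlgebraicGeometry.Motives

end
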